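import Mathlib

/-!
# Galois CM fields in Mathlib's language: conjugation as a central involution of `Gal(K/ℚ)`

Blind re-derivation cell `pub-hodge-repro`, seat `typer-2`.  Mathlib only.

Mathlib has `NumberField.IsCMField K` (totally complex quadratic extension of its maximal real
subfield `K⁺`, `Mathlib/NumberTheory/NumberField/CMField.lean`) with the complex conjugation
`NumberField.IsCMField.complexConj K : K ≃ₐ[K⁺] K`, characterised by
`NumberField.IsCMField.isConj_complexConj : ∀ φ : K →+* ℂ, ComplexEmbedding.IsConj φ (complexConj K)`,
i.e. `conj ∘ φ = φ ∘ complexConj K` for EVERY complex embedding `φ`.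

This file supplies the dictionary between that and the finite-group model used by the Tier-2
interface (`CMType.lean`: a finite group `G` with a central involution `c`, CM types as subsets of `G`):

* `conjGal K : Gal(K/ℚ)` — complex conjugation as an element of the absolute Galois group of `K`;
  `isConj_conjGal`, `conjGal_mul_self`, `conjGal_ne_one`, `conjGal_comm` (it is a central involution —
  the three fields of `HodgeRepro.IsComplexConj`);
* `embEquiv K φ₀ : Gal(K/ℚ) ≃ (K →+* ℂ)`, `g ↦ φ₀ ∘ g`, for `K/ℚ` Galois; under it complex conjugation
  of embeddings is LEFT multiplication by `conjGal K` (`conjugate_embEquiv`), precomposition by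
  `τ ∈ Gal(K/ℚ)` is RIGHT multiplication (`embEquiv_comp`), and changing the base point
  `φ₀ ↦ φ₀ ∘ τ` is LEFT multiplication (`embEquiv_comp_base`) — this is how the action of `Aut(ℂ)` on
  `Hom(K, ℂ)` (the action relevant for Galois conjugates of a CM type) shows up in the model;
* `IsCMTypeEmb Φ` — a CM type as a `Finset (K →+* ℂ)` containing one embedding of each conjugate pair —
  and its transport to the finite-group model (`isCMTypeEmb_iff`), together with `2 |Φ| = [K : ℚ]`.
-/

open NumberField ComplexEmbedding

namespace HodgeRepro.CMGalois

variable (K : Type*) [Field K] [NumberField K] [IsCMField K]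

/-- Complex conjugation of the CM field `K`, as an element of `Gal(K/ℚ)`. -/
noncomputable def conjGal : K ≃ₐ[ℚ] K :=
  AlgEquiv.ofRingEquiv (f := (IsCMField.complexConj K).toRingEquiv) (fun x => by simp)

/-- `conjGal K` acts as Mathlib's `complexConj`. -/
@[simp] theorem conjGal_apply (x : K) : conjGal K x = IsCMField.complexConj K x := rfl

/-- `conjGal K` is the conjugation of every complex embedding of `K`. -/
theorem isConj_conjGal (φ : K →+* ℂ) : ComplexEmbedding.IsConj φ (conjGal K) := by
  have h := IsCMField.isConj_complexConj K φ
  unfold ComplexEmbedding.IsConj at h ⊢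
  ext x
  exact RingHom.congr_fun h x

/-- Conjugation is an involution. -/
theorem conjGal_mul_self : conjGal K * conjGal K = 1 := by
  ext x
  simp [AlgEquiv.mul_apply]

/-- Conjugation is not the identity (`K` is totally complex). -/
theorem conjGal_ne_one : conjGal K ≠ 1 := by
  intro h
  apply IsCMField.complexConj_ne_one K
  ext x
  simpa using AlgEquiv.congr_fun h x

/-- Conjugation is central in `Gal(K/ℚ)`: it is *the* conjugation of every embedding, and the
conjugation of `φ ∘ ν` is `ν⁻¹ (conjugation of φ) ν`. -/
theorem conjGal_comm (ν : K ≃ₐ[ℚ] K) : conjGal K * ν = ν * conjGal K := by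
  let φ₀ : K →+* ℂ := Classical.choice (inferInstance : Nonempty _)
  have h1 : ComplexEmbedding.IsConj (φ₀.comp ν) (ν⁻¹ * conjGal K * ν) :=
    (isConj_conjGal K φ₀).comp ν
  have h2 : ComplexEmbedding.IsConj (φ₀.comp ν) (conjGal K) := isConj_conjGal K (φ₀.comp ν)
  have h3 : conjGal K = ν⁻¹ * conjGal K * ν := ComplexEmbedding.IsConj.ext h2 h1
  calc conjGal K * ν = ν * (ν⁻¹ * conjGal K * ν) := by group
    _ = ν * conjGal K := by rw [← h3]

/-- Conjugation is its own inverse. -/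
theorem conjGal_inv : (conjGal K)⁻¹ = conjGal K := by
  rw [inv_eq_iff_mul_eq_one, conjGal_mul_self]

/-! ### Embeddings versus the Galois group (for `K/ℚ` Galois) -/

section Galois

variable [IsGalois ℚ K]

/-- For `K/ℚ` Galois and a base embedding `φ₀`, the map `g ↦ φ₀ ∘ g` is a bijection
`Gal(K/ℚ) ≃ Hom(K, ℂ)`. -/
noncomputable def embEquiv (φ₀ : K →+* ℂ) : (K ≃ₐ[ℚ] K) ≃ (K →+* ℂ) :=
  Equiv.ofBijective (fun g => φ₀.comp g) <| by
    constructor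
    · intro g g' h
      exact AlgEquiv.ext fun x => φ₀.injective (RingHom.congr_fun h x)
    · intro ψ
      obtain ⟨σ, hσ⟩ := exists_comp_symm_eq_of_comp_eq (k := ℚ) φ₀ ψ (Subsingleton.elim _ _)
      exact ⟨σ.symm, hσ⟩

omit [IsCMField K] in
/-- `embEquiv K φ₀ g = φ₀ ∘ g`. -/
@[simp] theorem embEquiv_apply (φ₀ : K →+* ℂ) (g : K ≃ₐ[ℚ] K) :
    embEquiv K φ₀ g = φ₀.comp g := rfl

/-- Complex conjugation of embeddings is LEFT multiplication by `conjGal K`. -/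
theorem conjugate_embEquiv (φ₀ : K →+* ℂ) (g : K ≃ₐ[ℚ] K) :
    conjugate (embEquiv K φ₀ g) = embEquiv K φ₀ (conjGal K * g) := by
  have h : conjugate φ₀ = φ₀.comp (conjGal K) := isConj_conjGal K φ₀
  ext x
  have hx := RingHom.congr_fun h (g x)
  simp only [ComplexEmbedding.conjugate_coe_eq, RingHom.comp_apply, RingHom.coe_coe] at hx
  simp only [ComplexEmbedding.conjugate_coe_eq, embEquiv_apply, RingHom.comp_apply,
    RingHom.coe_coe, AlgEquiv.mul_apply, hx]

omit [IsCMField K] in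
/-- Precomposition with `τ ∈ Gal(K/ℚ)` is RIGHT multiplication. -/
theorem embEquiv_comp (φ₀ : K →+* ℂ) (g τ : K ≃ₐ[ℚ] K) :
    (embEquiv K φ₀ g).comp τ = embEquiv K φ₀ (g * τ) := by
  ext x
  simp [AlgEquiv.mul_apply]

omit [IsCMField K] in
/-- Changing the base embedding `φ₀ ↦ φ₀ ∘ τ` is LEFT multiplication by `τ`. -/
theorem embEquiv_comp_base (φ₀ : K →+* ℂ) (g τ : K ≃ₐ[ℚ] K) :
    embEquiv K (φ₀.comp τ) g = embEquiv K φ₀ (τ * g) := by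
  ext x
  simp [AlgEquiv.mul_apply]

omit [IsGalois ℚ K] in
/-- The conjugate of `φ₀` is `φ₀ ∘ conjGal K`. -/
theorem conjugate_eq_comp_conjGal (φ₀ : K →+* ℂ) : conjugate φ₀ = φ₀.comp (conjGal K) :=
  isConj_conjGal K φ₀

end Galois

/-! ### CM types as sets of complex embeddings -/

section CMTypeEmb

variable {K}

/-- A CM type of `K` as a set of complex embeddings: exactly one of each conjugate pair `{φ, φ̄}`. -/
def IsCMTypeEmb (Φ : Finset (K →+* ℂ)) : Prop :=
  ∀ φ : K →+* ℂ, φ ∈ Φ ↔ conjugate φ ∉ Φ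

/-- No embedding of a totally complex field is fixed by conjugation. -/
theorem conjugate_ne (φ : K →+* ℂ) : conjugate φ ≠ φ := by
  intro h
  exact IsTotallyComplex.complexEmbedding_not_isReal φ (isReal_iff.mpr h)

omit [IsCMField K] in
open scoped Classical in
/-- The conjugate CM type is the complement. -/
theorem IsCMTypeEmb.image_conjugate_eq_compl {Φ : Finset (K →+* ℂ)} (hΦ : IsCMTypeEmb Φ) :
    Φ.image conjugate = Φᶜ := by
  ext φ
  simp only [Finset.mem_image, Finset.mem_compl]
  constructor
  · rintro ⟨ψ, hψ, rfl⟩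
    exact (hΦ ψ).1 hψ
  · intro h
    refine ⟨conjugate φ, ?_, by simp⟩
    by_contra h'
    exact h ((hΦ φ).2 h')

omit [IsCMField K] in
/-- A CM type contains exactly half of the embeddings: `2 |Φ| = [K : ℚ]`. -/
theorem IsCMTypeEmb.two_mul_card {Φ : Finset (K →+* ℂ)} (hΦ : IsCMTypeEmb Φ) :
    2 * Φ.card = Module.finrank ℚ K := by
  classical
  have h1 : (Φ.image conjugate).card = Φ.card :=
    Finset.card_image_of_injective _ (involutive_conjugate K).injective
  have h2 := Finset.card_compl Φ
  rw [← hΦ.image_conjugate_eq_compl, h1] at h2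
  rw [← Embeddings.card K ℂ]
  omega

variable [IsGalois ℚ K]

/-- Transport of the CM-type condition to the finite-group model: `Φ` is a CM type of embeddings iff
its pull-back `Φ' ⊆ Gal(K/ℚ)` along `embEquiv K φ₀` contains exactly one of each pair
`{g, conjGal K * g}` — this is `HodgeRepro.IsCMType (conjGal K) Φ'` of `CMType.lean`. -/
theorem isCMTypeEmb_iff (φ₀ : K →+* ℂ) (Φ : Finset (K →+* ℂ)) :
    IsCMTypeEmb Φ ↔
      ∀ g : K ≃ₐ[ℚ] K, g ∈ Φ.map (embEquiv K φ₀).symm.toEmbedding ↔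
        conjGal K * g ∉ Φ.map (embEquiv K φ₀).symm.toEmbedding := by
  unfold IsCMTypeEmb
  rw [← (embEquiv K φ₀).forall_congr_right]
  refine forall_congr' fun g => ?_
  simp only [Finset.mem_map_equiv, Equiv.symm_symm, conjugate_embEquiv]

end CMTypeEmb

end HodgeRepro.CMGalois
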